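import Literature.Computability.AlgebraicComplexity.Poonen05HypersurfaceLinearAutomorphisms
import Literature.Computability.AlgebraicComplexity.GLAnnihilator
import Literature.RingTheory.MvPolynomial.HomogeneousSopRegularSequence
import Literature.RingTheory.KrullDimension.TangentDimension
import Literature.RingTheory.KrullDimension.ZariskiClosureInfinite
import Mathlib.RingTheory.MvPolynomial.EulerIdentity
import Mathlib.Algebra.DualNumber
import HarnessLib

/-!
# Smooth forms of degree `d ≥ 3` have finite linear stabilizer over every algebraically closed field
# of characteristic not dividing `d` (Poonen 2005 Thm. 2 / Matsumura–Monsky beyond `ℂ`)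

Topic `Literature/Computability/AlgebraicComplexity` (cell `val-lit`, row X3-Poonen05). Theorems only —
no definition, no named fact.

Poonen, *Varieties without extra automorphisms I: curves* (2005), Thm. 2 (p0002:L9): "If `n ≥ 1` and
`d ≥ 3`, then `Lin X` is finite" for every smooth hypersurface `X ⊂ ℙ^{n+1}` of degree `d`
(Matsumura–Monsky 1964 / Orlik–Solomon). The tree's named fact `poonen2005_thm_2`
(`Poonen05HypersurfaceLinearAutomorphisms.lean`) quantifies over EVERY algebraically closed field; the
instance `K = ℂ` is `SmoothFormFiniteStabilizer.poonen2005_thm_2_complex` (weights / Jordan–Chevalley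
route). This file proves the statement for **every algebraically closed field `K` with `(d : K) ≠ 0`**
(characteristic `0`, or characteristic `p ∤ d`) by the Koszul route, entirely in the tree's
field-general vocabulary (no `glAnn`, which is typed over `ℂ`: the infinitesimal stabiliser is
spelled out as `Σ_{a,b} M_{ab} · x_a ∂_b F`):

* `linSubst_one_add_smul` — first-order expansion of a unipotent substitution over any commutative
  ring: for `ε² = 0`, `(1 + εM) · F = F + ε Σ_{a,b} M_{ab} x_a ∂_b F` (Springer 4.1.2, dual numbers).
* `X_pow_mem_span_pderiv_of_isNonsingularForm`, `eq_zero_of_sum_linear_mul_pderiv_eq_zero` — for a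
  nonsingular form `F` of degree `d`, `(d : K) ≠ 0`: every variable has a power in the Jacobian ideal
  (Euler's identity), so the partials are a homogeneous system of parameters, hence a regular sequence
  with Koszul syzygies (`HomogeneousSopRegularSequence.lean`, Macaulay), and for `d ≥ 3` they admit
  NO LINEAR SYZYGY; `eq_zero_of_sum_smul_X_mul_pderiv_eq_zero` — the infinitesimal stabiliser of `F`
  in `𝔤𝔩_{n+2}` is zero.
* `finite_linStabilizer_of_forall_sum_smul_X_mul_pderiv` — **over ANY field: a polynomial whose
  infinitesimal stabiliser is zero has a finite stabiliser `stab(F) ⊆ GL`** (the field-general,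
  definition-free form of `BI17FiniteStabilizerLocusProofs.finite_linStabilizer_of_glAnn_eq_bot`,
  same engine: an infinite stabiliser has a positive-dimensional component in its Zariski closure
  (`KrullDimension.exists_mem_minimalPrimes_inter_infinite`), hence a stabiliser point `g₀` with a
  non-zero Zariski tangent vector `B` (`KrullDimension.height_le_finrank_tangentSpaceAt`, Springer
  4.3.3 (iii)); differentiating the stabiliser equations at `g₀` along `B` with dual numbers
  (`KrullDimension.snd_aeval_dualNumberPoint`) and writing `g₀ + εB = (1 + εM) g₀` gives
  `Σ M_{ab} x_a ∂_b F = 0` with `M = B g₀⁻¹ ≠ 0`).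
* `finite_linStabilizer_of_isNonsingularForm_of_natCast_ne_zero`,
  **`poonen2005_thm_2_of_natCast_ne_zero`** (the body of the fact verbatim, plus the single
  hypothesis `(d : K) ≠ 0`) and `poonen2005_thm_2_of_charZero`.
* `forall_sum_smul_X_mul_pderiv_iff_glAnn_eq_bot` — the `ℂ`-bridge: over `ℂ` the definition-free
  Lie condition is `glAnn P = ⊥` (`GLAnnihilator.mem_glAnn_iff`), so `ℂ`-consumers convert in one
  line; nothing is re-derived over `ℂ` (the `ℂ` statements are `SmoothFormFiniteStabilizer.lean`'s
  `glAnn_eq_bot_of_isNonsingularForm` / `finite_linStabilizer_of_isNonsingularForm` /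
  `poonen2005_thm_2_complex` and `BI17FiniteStabilizerLocusProofs.finite_linStabilizer_of_glAnn_eq_bot`;
  two `example`s at the end check that the present file specialises to them).

Typed vs printed / what stays open. Poonen 2005 Thm. 2 is stated for every field `k` (finiteness
of `Lin X` over `k̄`), with Matsumura–Monsky 1963/64 and Orlik–Solomon behind it; the tree's fact
`poonen2005_thm_2` renders it for algebraically closed `K` of ANY characteristic. Typed HERE:
algebraically closed `K` with `(d : K) ≠ 0` (char `K ∤ d`), `d ≥ 3`, `n ≥ 1`, conclusion = the
fact's body verbatim plus that one hypothesis. The fact itself is NOT discharged and stays OPEN BY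
NAME: in characteristic `p ∣ d` Euler's identity degenerates (`Σ xᵢ ∂ᵢF = d·F = 0`, so the identity
matrix IS an infinitesimal stabiliser — the Lie-level statement
`eq_zero_of_sum_smul_X_mul_pderiv_eq_zero` is then FALSE — and the partials are never a regular
sequence), and Matsumura–Monsky's finiteness there (1964, §3) rests on a different, group-level
argument. Honest framing: classical invariant theory of hypersurfaces; typed ≠ endorsed; nothing
here bears on `VP ≠ VNP`, which is NOT proved.

## References

* B. Poonen, *Varieties without extra automorphisms I: curves*, Math. Res. Lett. 7 (2000) 67–76,
  Thm. 2. [Poonen2005]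
* H. Matsumura, *Commutative Ring Theory*, CUP 1987, Thm. 16.5 (i) (Koszul complex of a regular
  sequence). [Matsumura1987]
* T. A. Springer, *Linear Algebraic Groups*, 2nd ed., 4.1.2 (dual numbers), 4.3.3 (iii).
  [SpringerLAG1998]
-/

noncomputable section

open MvPolynomial Matrix

namespace Literature.Computability.AlgebraicComplexity

open Literature.AlgebraicGeometry.Motives.SmoothHypersurface (IsNonsingularForm)

/-! ### First-order expansion of a unipotent substitution -/

section FirstOrder

variable {R : Type*} [CommRing R] {σ : Type*} [Fintype σ] [DecidableEq σ]

/-- The column of `1 + εM` acting on `x_l`: `x_l ↦ x_l + ε Σ_j M_{jl} x_j`. [folklore] -/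
private theorem sum_one_add_smul_apply_smul_X (ε : R) (M : Matrix σ σ R) (l : σ) :
    (∑ j, (1 + ε • M) j l • X j : MvPolynomial σ R) = X l + ε • ∑ j, M j l • X j := by
  simp only [Matrix.add_apply, Matrix.one_apply, Matrix.smul_apply, smul_eq_mul, add_smul,
    Finset.sum_add_distrib, ite_smul, one_smul, zero_smul, Finset.sum_ite_eq', Finset.mem_univ,
    if_true, Finset.smul_sum, smul_smul]

/-- **First-order expansion of a unipotent substitution** (any commutative ring): for `ε² = 0` and a
square matrix `M`, `(1 + εM) · F = F + ε · Σ_{a,b} M_{ab} x_a ∂_b F` — the substitution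
`x_b ↦ x_b + ε Σ_a M_{ab} x_a`, Taylor to first order (Springer 4.1.2:
"`p(x + tv) ≡ p(x) + t Σ vᵢ ∂p/∂Tᵢ (x) mod t²`"). [cite: SpringerLAG1998, 4.1.2] -/
theorem linSubst_one_add_smul {ε : R} (hε : ε * ε = 0) (M : Matrix σ σ R)
    (F : MvPolynomial σ R) :
    linSubst σ R (1 + ε • M) F = F + ε • ∑ a, ∑ b, M a b • (X a * pderiv b F) := by
  induction F using MvPolynomial.induction_on with
  | C c =>
    rw [linSubst_C]
    simp only [pderiv_C, mul_zero, smul_zero, Finset.sum_const_zero, add_zero]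
  | add p q hp hq =>
    rw [map_add, hp, hq]
    simp only [map_add, mul_add, smul_add, Finset.sum_add_distrib]
    abel
  | mul_X p l hp =>
    rw [map_mul, hp, linSubst_X, sum_one_add_smul_apply_smul_X]
    have hε' : (C ε : MvPolynomial σ R) * C ε = 0 := by rw [← C_mul, hε, C_0]
    set T := ∑ a, ∑ b, M a b • (X a * pderiv b p) with hT
    set L := ∑ j, M j l • (X j : MvPolynomial σ R) with hL
    have h1 : ∑ a, ∑ b, M a b • (X a * pderiv b (p * X l)) = T * X l + L * p := by
      have hder : ∀ b, pderiv b (p * X l) = X l * pderiv b p + if l = b then p else 0 := by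
        intro b
        rw [Derivation.leibniz, pderiv_X, smul_eq_mul, smul_eq_mul, Pi.single_apply, mul_ite,
          mul_one, mul_zero, add_comm]
      simp_rw [hder, mul_add, smul_add, Finset.sum_add_distrib, mul_ite, mul_zero, smul_ite,
        smul_zero, Finset.sum_ite_eq, Finset.mem_univ, if_true]
      rw [hT, hL, Finset.sum_mul, Finset.sum_mul]
      congr 1
      · refine Finset.sum_congr rfl fun a _ => ?_
        rw [Finset.sum_mul]
        refine Finset.sum_congr rfl fun b _ => ?_
        rw [smul_mul_assoc]
        congr 1
        ring
      · refine Finset.sum_congr rfl fun a _ => ?_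
        rw [smul_mul_assoc]
    rw [h1]
    simp only [smul_eq_C_mul]
    linear_combination (T * L) * hε'

end FirstOrder

/-! ### The Jacobian ideal of a nonsingular form, `(d : K) ≠ 0` -/

section Jacobian

variable {K : Type*} [Field K] {n : ℕ}

/-- **Every variable has a power in the Jacobian ideal of a nonsingular form** of degree `d` with
`(d : K) ≠ 0`: a prime containing all `∂ⱼF` contains `d·F = Σ xⱼ ∂ⱼF` (Euler), hence `F`, hence —
`F` being nonsingular — every variable; so each `xᵢ` lies in the radical of `(∂₀F, …, ∂_{n+1}F)`
(Poonen's smoothness hypothesis in the form used by [MM]/[OS]: `F_{x₀}, …, F_{x_{n+1}}` have no common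
zero). [cite: Poonen2005, Thm. 2 (setting)] -/
theorem X_pow_mem_span_pderiv_of_isNonsingularForm {F : MvPolynomial (Fin (n + 2)) K}
    {d : ℕ} (hF : F.IsHomogeneous d) (hdK : (d : K) ≠ 0) (hns : IsNonsingularForm K F)
    (i : Fin (n + 2)) :
    ∃ N : ℕ, (X i : MvPolynomial (Fin (n + 2)) K) ^ N ∈
      Ideal.span (Set.range fun j : Fin (n + 2) => pderiv j F) := by
  set J : Ideal (MvPolynomial (Fin (n + 2)) K) := Ideal.span (Set.range fun j => pderiv j F)
    with hJ_def
  suffices hrad : (X i : MvPolynomial (Fin (n + 2)) K) ∈ J.radical from Ideal.mem_radical_iff.1 hrad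
  rw [Ideal.radical_eq_sInf, Submodule.mem_sInf]
  rintro 𝔭 ⟨hJ𝔭, h𝔭⟩
  have hder : ∀ j, pderiv j F ∈ 𝔭 := fun j => hJ𝔭 (Ideal.subset_span ⟨j, rfl⟩)
  -- Euler: `d • F = Σ x_j ∂_j F ∈ 𝔭`
  have hdF : (d : MvPolynomial (Fin (n + 2)) K) * F ∈ 𝔭 := by
    rw [← nsmul_eq_mul, ← hF.sum_X_mul_pderiv]
    exact Ideal.sum_mem _ fun j _ => Ideal.mul_mem_left _ _ (hder j)
  have hunit : IsUnit (d : MvPolynomial (Fin (n + 2)) K) := by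
    rw [← map_natCast (C : K →+* MvPolynomial (Fin (n + 2)) K) d]
    exact (IsUnit.mk0 _ hdK).map C
  have hF𝔭 : F ∈ 𝔭 := (Ideal.unit_mul_mem_iff_mem 𝔭 hunit).1 hdF
  exact hns 𝔭 h𝔭 hF𝔭 hder i

/-- **The partial derivatives of a nonsingular form of degree `d ≥ 3`, `(d : K) ≠ 0`, admit no
linear syzygy**: if `ℓ₀, …, ℓ_{n+1}` are linear forms with `Σⱼ ℓⱼ ∂ⱼF = 0`, then all `ℓⱼ = 0`. The
`∂ⱼF` are a homogeneous system of parameters (previous lemma), hence a regular sequence with Koszul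
syzygies (`HomogeneousSopRegularSequence.lean`), and `deg ℓⱼ = 1 < d − 1 = deg ∂ⱼF`. This is the
commutative-algebra core of [MM] Thm. 1 / Orlik–Solomon.
[cite: Poonen2005, Thm. 2] [cite: Matsumura1987, Thm. 16.5 (i)] -/
theorem eq_zero_of_sum_linear_mul_pderiv_eq_zero {F : MvPolynomial (Fin (n + 2)) K}
    {d : ℕ} (hF : F.IsHomogeneous d) (hd : 3 ≤ d) (hdK : (d : K) ≠ 0) (hns : IsNonsingularForm K F)
    {ℓ : Fin (n + 2) → MvPolynomial (Fin (n + 2)) K} (hℓ : ∀ j, (ℓ j).IsHomogeneous 1)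
    (hrel : ∑ j, ℓ j * pderiv j F = 0) (j : Fin (n + 2)) : ℓ j = 0 :=
  Literature.RingTheory.MvPolynomial.eq_zero_of_sum_mul_eq_zero_of_isHomogeneous_lt
    (fun j : Fin (n + 2) => pderiv j F) (e := fun _ => d - 1) (fun _ => hF.pderiv)
    (fun _ => by omega) (X_pow_mem_span_pderiv_of_isNonsingularForm hF hdK hns)
    (t := 1) (fun _ => by omega) hℓ hrel j

/-- **The infinitesimal stabiliser of a nonsingular form of degree `d ≥ 3` is zero** when
`(d : K) ≠ 0`: if `Σ_{a,b} M_{ab} · x_a ∂_b F = 0` for a square matrix `M` (this is `X·F = 0` for the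
Lie algebra action of `𝔤𝔩_{n+2}`, `SmoothFormAnnihilatorSemisimple.glTangentMap_eq_sum_mul_pderiv`),
then `M = 0` — the linear forms `ℓ_b = Σ_a M_{ab} x_a` are a linear syzygy of the partials
(infinitesimal Matsumura–Monsky: [MM] Thm. 1, Poonen Thm. 2 in Lie-algebra form).
[cite: Poonen2005, Thm. 2] -/
theorem eq_zero_of_sum_smul_X_mul_pderiv_eq_zero {F : MvPolynomial (Fin (n + 2)) K} {d : ℕ}
    (hF : F.IsHomogeneous d) (hd : 3 ≤ d) (hdK : (d : K) ≠ 0) (hns : IsNonsingularForm K F)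
    (M : Matrix (Fin (n + 2)) (Fin (n + 2)) K)
    (hM : ∑ a, ∑ b, M a b • (X a * pderiv b F : MvPolynomial (Fin (n + 2)) K) = 0) : M = 0 := by
  classical
  -- the linear forms `ℓ_b = Σ_a M_{ab} x_a`
  set ℓ : Fin (n + 2) → MvPolynomial (Fin (n + 2)) K :=
    fun b => ∑ a, M a b • (MvPolynomial.X a : MvPolynomial (Fin (n + 2)) K) with hℓ_def
  have hℓ : ∀ b, (ℓ b).IsHomogeneous 1 := by
    intro b
    refine IsHomogeneous.sum _ _ _ fun a _ => ?_
    rw [smul_eq_C_mul]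
    simpa using (isHomogeneous_C (Fin (n + 2)) (M a b)).mul (isHomogeneous_X K a)
  have hrel : ∑ b, ℓ b * pderiv b F = 0 := by
    rw [← hM, Finset.sum_comm]
    refine Finset.sum_congr rfl fun b _ => ?_
    rw [hℓ_def, Finset.sum_mul]
    refine Finset.sum_congr rfl fun a _ => ?_
    rw [smul_mul_assoc]
  have hzero : ∀ b, ℓ b = 0 := eq_zero_of_sum_linear_mul_pderiv_eq_zero hF hd hdK hns hℓ hrel
  -- read off the entries: `M_{ab}` is the coefficient of `x_a` in `ℓ_b`
  ext a b
  have hcoef : coeff (Finsupp.single a 1) (ℓ b) = M a b := by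
    simp only [hℓ_def, coeff_sum, coeff_smul, coeff_X, smul_eq_mul]
    rw [Finset.sum_eq_single a]
    · rw [if_pos rfl, mul_one]
    · intro a' _ ha'
      rw [if_neg, mul_zero]
      intro h
      exact ha' (Finsupp.single_left_injective one_ne_zero h)
    · intro h
      exact absurd (Finset.mem_univ a) h
  rw [hzero b, coeff_zero] at hcoef
  rw [Matrix.zero_apply, ← hcoef]

end Jacobian

/-! ### Zero infinitesimal stabiliser ⇒ finite stabiliser, over any field -/

section Finite

variable {K : Type*} [Field K] {σ : Type*} [Fintype σ]

open TrivSqZeroExt DualNumber Literature.RingTheory.KrullDimension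

/-- Base change for `linSubst` (private copy of the tree lemma of `BLMW11HilbertKraftReduction`).
[folklore] -/
private theorem map_linSubst₃ {R S : Type*} [CommRing R] [CommRing S] (θ : R →+* S)
    (A : Matrix σ σ R) (p : MvPolynomial σ R) :
    MvPolynomial.map θ (linSubst σ R A p) = linSubst σ S (A.map θ) (MvPolynomial.map θ p) := by
  change MvPolynomial.map θ (aeval _ p) = aeval _ (MvPolynomial.map θ p)
  rw [aeval_eq_bind₁, aeval_eq_bind₁, map_bind₁]
  congr 2
  funext i
  simp only [map_sum, smul_eq_C_mul, map_mul, map_C, map_X, Matrix.map_apply]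

/-- The generic coefficient functions of the orbit map: evaluating
`coeff_e ((Y)·F)`, `Y` the generic matrix over `K[Y_{ij}]`, at an `S`-valued point `q` gives
`coeff_e` of the substituted polynomial over `S`. [folklore] -/
private theorem aeval_coeff_linSubst_generic {S : Type*} [CommRing S] [Algebra K S]
    (F : MvPolynomial σ K) (q : σ × σ → S) (e : σ →₀ ℕ) :
    aeval q (coeff e (linSubst σ (MvPolynomial (σ × σ) K)
      (Matrix.of fun i j => (X (i, j) : MvPolynomial (σ × σ) K))
      (MvPolynomial.map (algebraMap K (MvPolynomial (σ × σ) K)) F))) =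
      coeff e (linSubst σ S (Matrix.of fun i j => q (i, j))
        (MvPolynomial.map (algebraMap K S) F)) := by
  have hY : (Matrix.of fun i j => (X (i, j) : MvPolynomial (σ × σ) K)).map
      (aeval (R := K) q : MvPolynomial (σ × σ) K →+* S) = Matrix.of fun i j => q (i, j) := by
    ext i j
    rw [Matrix.map_apply, Matrix.of_apply, Matrix.of_apply, RingHom.coe_coe, aeval_X]
  have hF : MvPolynomial.map (aeval (R := K) q : MvPolynomial (σ × σ) K →+* S)
      (MvPolynomial.map (algebraMap K (MvPolynomial (σ × σ) K)) F) =
      MvPolynomial.map (algebraMap K S) F := by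
    have hcomp : (aeval (R := K) q : MvPolynomial (σ × σ) K →+* S).comp
        (algebraMap K (MvPolynomial (σ × σ) K)) = algebraMap K S :=
      RingHom.ext fun c => by rw [RingHom.comp_apply, RingHom.coe_coe, AlgHom.commutes]
    rw [MvPolynomial.map_map, hcomp]
  rw [← RingHom.coe_coe, ← coeff_map, map_linSubst₃, hY, hF]

variable [DecidableEq σ]

/-- **Zero infinitesimal stabiliser forces a finite stabiliser, over any field.** If the only square
matrix `M` with `Σ_{a,b} M_{ab} · x_a ∂_b F = 0` is `M = 0`, then `stab(F) ⊆ GL` is finite. If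
`stab(F)` is infinite, the Zariski closure of this set of points of `Mat` has a positive-dimensional
component `Z(𝔭)` (`exists_mem_minimalPrimes_inter_infinite`); at a stabiliser point `g₀ ∈ Z(𝔭)` the
maximal ideal has positive height, so the Zariski tangent space `T_{g₀}` is non-zero
(`height_le_finrank_tangentSpaceAt`, Springer 4.3.3 (iii)); a tangent vector `B ≠ 0` kills the
differentials of the stabiliser equations `coeff_e(Y·F) − coeff_e F ∈ 𝔭`, i.e. (dual numbers,
`snd_aeval_dualNumberPoint`) `coeff_e ((g₀ + εB)·F)` has no `ε`-part; writing
`g₀ + εB = (1 + εM) g₀` with `M = B g₀⁻¹` and using `g₀·F = F` and `linSubst_one_add_smul`, this says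
`Σ M_{ab} x_a ∂_b F = 0`, so `M = 0`, `B = 0` — contradiction. (Field-general, definition-free form
of `BI17FiniteStabilizerLocusProofs.finite_linStabilizer_of_glAnn_eq_bot`.)
[cite: SpringerLAG1998, Thm 4.3.3 (iii)] -/
theorem finite_linStabilizer_of_forall_sum_smul_X_mul_pderiv (F : MvPolynomial σ K)
    (h : ∀ M : Matrix σ σ K, ∑ a, ∑ b, M a b • (X a * pderiv b F : MvPolynomial σ K) = 0 → M = 0) :
    Finite (linStabilizer F) := by
  classical
  by_contra hinf
  rw [not_finite_iff_infinite] at hinf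
  -- the stabilizer as an infinite set of points of matrix space
  let pt : GL σ K → (σ × σ → K) := fun γ ij => (γ : Matrix σ σ K) ij.1 ij.2
  have hpt_inj : Function.Injective pt := by
    intro γ γ' hγ
    exact Matrix.GeneralLinearGroup.ext fun i j => congr_fun hγ (i, j)
  set S : Set (σ × σ → K) := pt '' (linStabilizer F : Set (GL σ K)) with hS
  have hSinf : S.Infinite :=
    (Set.infinite_coe_iff.mp hinf).image hpt_inj.injOn
  obtain ⟨𝔭, h𝔭min, hinf', -, hnotmax, -⟩ :=
    exists_mem_minimalPrimes_inter_infinite (k := K) (K := K) hSinf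
  haveI h𝔭 : 𝔭.IsPrime := h𝔭min.1.1
  have hIS : MvPolynomial.vanishingIdeal K S ≤ 𝔭 := h𝔭min.1.2
  obtain ⟨a, haS, ha𝔭⟩ := hinf'.nonempty
  obtain ⟨γ₀, hγ₀, rfl⟩ := haS
  have hγ₀F : linSubst σ K (γ₀ : Matrix σ σ K) F = F := by
    have := mem_linStabilizer.mp hγ₀
    rwa [linSubstRep_apply] at this
  have ha : ∀ p ∈ 𝔭, eval (pt γ₀) p = 0 := fun p hp => by
    rw [← aeval_apply_eq_eval]; exact (MvPolynomial.mem_zeroLocus_iff.mp ha𝔭) p hp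
  -- the maximal ideal of `g₀` in `K[Y] ⧸ 𝔭` has positive height, so the tangent space is non-zero
  haveI : IsDomain (MvPolynomial (σ × σ) K ⧸ 𝔭) := Ideal.Quotient.isDomain 𝔭
  have hnf : ¬ IsField (MvPolynomial (σ × σ) K ⧸ 𝔭) := fun hF =>
    hnotmax ((Ideal.Quotient.maximal_ideal_iff_isField_quotient 𝔭).mpr hF)
  haveI := isMaximal_pointIdeal (pointOfZero 𝔭 (pt γ₀) ha)
  have hbot : ⊥ < pointIdeal (pointOfZero 𝔭 (pt γ₀) ha) := Ideal.bot_lt_of_maximal _ hnf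
  have hheight : (pointIdeal (pointOfZero 𝔭 (pt γ₀) ha)).height ≠ 0 := by
    rw [Ne, Ideal.height_eq_zero_iff_eq_bot]
    exact hbot.ne'
  have h1 : (1 : ℕ∞) ≤ Module.finrank K (tangentSpaceAt 𝔭 (pt γ₀)) :=
    (Order.one_le_iff_ne_zero.mpr hheight).trans (height_le_finrank_tangentSpaceAt 𝔭 (pt γ₀) ha)
  have h1' : 0 < Module.finrank K (tangentSpaceAt 𝔭 (pt γ₀)) := by
    have : (1 : ℕ) ≤ Module.finrank K (tangentSpaceAt 𝔭 (pt γ₀)) := by exact_mod_cast h1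
    omega
  obtain ⟨v, hv⟩ := Module.finrank_pos_iff_exists_ne_zero.mp h1'
  -- the tangent vector as a matrix `B`, and `M = B g₀⁻¹`
  set B : Matrix σ σ K := Matrix.of fun i j => (v : σ × σ → K) (i, j) with hB
  have hBne : B ≠ 0 := by
    intro hB0
    apply hv
    apply Subtype.ext
    funext ij
    have := congr_fun (congr_fun hB0 ij.1) ij.2
    simpa [hB] using this
  set g₀ : Matrix σ σ K := (γ₀ : Matrix σ σ K) with hg₀
  set g₀i : Matrix σ σ K := ((γ₀⁻¹ : GL σ K) : Matrix σ σ K) with hg₀i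
  have hgi : g₀i * g₀ = 1 := by
    rw [hg₀i, hg₀, ← Units.val_mul, inv_mul_cancel, Units.val_one]
  set M : Matrix σ σ K := B * g₀i with hM
  have hMg : M * g₀ = B := by rw [hM, Matrix.mul_assoc, hgi, Matrix.mul_one]
  -- the key computation: `coeff_e (Σ M_{ab} x_a ∂_b F) = 0` for every `e`
  set T : MvPolynomial σ K := ∑ a, ∑ b, M a b • (X a * pderiv b F) with hT
  have key : ∀ e : σ →₀ ℕ, coeff e T = 0 := by
    intro e
    -- the stabilizer equation `coeff_e (Y·F) − coeff_e F` lies in `𝔭`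
    set Q : MvPolynomial (σ × σ) K := coeff e (linSubst σ (MvPolynomial (σ × σ) K)
      (Matrix.of fun i j => (X (i, j) : MvPolynomial (σ × σ) K))
      (MvPolynomial.map (algebraMap K (MvPolynomial (σ × σ) K)) F)) with hQ_def
    have hQ : Q - C (coeff e F) ∈ 𝔭 := by
      apply hIS
      rw [MvPolynomial.mem_vanishingIdeal_iff]
      rintro _ ⟨γ, hγ, rfl⟩
      have hγF : linSubst σ K (γ : Matrix σ σ K) F = F := by
        have := mem_linStabilizer.mp (show γ ∈ linStabilizer F from hγ)
        rwa [linSubstRep_apply] at this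
      have hpt : (Matrix.of fun i j => pt γ (i, j)) = (γ : Matrix σ σ K) := by
        ext i j; rfl
      rw [map_sub, aeval_C, hQ_def, aeval_coeff_linSubst_generic, hpt, Algebra.algebraMap_self,
        MvPolynomial.map_id, RingHom.id_apply, hγF, sub_self]
    -- its differential at `g₀` kills `v`
    have htan : linearFormOfVector (pt γ₀) (v : σ × σ → K) Q = 0 := by
      have h0 := linearFormOfVector_eq_zero 𝔭 (pt γ₀) v _ hQ
      rw [map_sub] at h0
      have hC : linearFormOfVector (pt γ₀) (v : σ × σ → K)
          (C (coeff e F) : MvPolynomial (σ × σ) K) = 0 := by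
        rw [linearFormOfVector_apply]
        simp only [pderiv_C, map_zero, zero_mul, Finset.sum_const_zero]
      rwa [hC, sub_zero] at h0
    -- dual numbers: the point `g₀ + εB = (1 + εM) g₀` of matrix space over `K[ε]`
    let ι : K →+* K[ε] := algebraMap K K[ε]
    have hεb : ∀ b : K, (ε : K[ε]) * inl b = inr b := fun b => by
      rw [(commute_eps_left _).eq, inl_mul_eq_smul, inr_eq_smul_eps]
    have hpoint : (Matrix.of fun i j => dualNumberPoint (pt γ₀) (v : σ × σ → K) (i, j)) =
        (1 + (ε : K[ε]) • M.map ι) * g₀.map ι := by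
      rw [add_mul, one_mul, Matrix.smul_mul, ← Matrix.map_mul, hMg]
      refine Matrix.ext fun i j => ?_
      simp only [Matrix.of_apply, dualNumberPoint, Matrix.add_apply, Matrix.map_apply,
        Matrix.smul_apply, smul_eq_mul, hB, pt, hg₀, ι, TrivSqZeroExt.algebraMap_eq_inl, hεb]
    have hFε : linSubst σ K[ε] (g₀.map ι) (MvPolynomial.map ι F) = MvPolynomial.map ι F := by
      rw [← map_linSubst₃, hγ₀F]
    have hTε : (∑ a, ∑ b, (M.map ι) a b • (X a * pderiv b (MvPolynomial.map ι F)) :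
        MvPolynomial σ K[ε]) = MvPolynomial.map ι T := by
      rw [hT, map_sum]
      refine Finset.sum_congr rfl fun a _ => ?_
      rw [map_sum]
      refine Finset.sum_congr rfl fun b _ => ?_
      rw [Matrix.map_apply, smul_eq_C_mul, smul_eq_C_mul, map_mul, map_C, map_mul, map_X,
        pderiv_map]
    have heval : aeval (dualNumberPoint (pt γ₀) (v : σ × σ → K)) Q =
        coeff e (MvPolynomial.map ι F) + (ε : K[ε]) * coeff e (MvPolynomial.map ι T) := by
      rw [hQ_def, aeval_coeff_linSubst_generic, hpoint, linSubst_mul, AlgHom.comp_apply, hFε,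
        linSubst_one_add_smul eps_mul_eps, hTε, coeff_add, coeff_smul, smul_eq_mul]
    -- compare the `ε`-parts
    have hsnd := congrArg TrivSqZeroExt.snd heval
    rw [snd_aeval_dualNumberPoint, htan, snd_add, coeff_map, coeff_map, DualNumber.snd_mul,
      fst_eps, snd_eps, zero_mul, zero_add, one_mul] at hsnd
    rw [TrivSqZeroExt.algebraMap_eq_inl] at hsnd
    rw [eq_comm]
    simpa using hsnd
  have hM0 : M = 0 := h M (MvPolynomial.ext _ _ fun e => by rw [← hT, key, coeff_zero])
  apply hBne
  rw [← hMg, hM0, Matrix.zero_mul]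

end Finite

/-! ### Poonen 2005, Thm. 2 for every algebraically closed field with `(d : K) ≠ 0` -/

section Poonen

variable {K : Type*} [Field K] {n : ℕ}

/-- **A nonsingular form of degree `d ≥ 3` with `(d : K) ≠ 0` has a finite stabiliser**
`stab(F) ⊆ GL_{n+2}(K)`, over ANY field `K` (Matsumura–Monsky 1964 Thm. 1 / Poonen 2005 Thm. 2,
linear part, characteristic `0` or `p ∤ d`). [cite: Poonen2005, Thm. 2] -/
theorem finite_linStabilizer_of_isNonsingularForm_of_natCast_ne_zero
    {F : MvPolynomial (Fin (n + 2)) K} {d : ℕ} (hF : F.IsHomogeneous d) (hd : 3 ≤ d)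
    (hdK : (d : K) ≠ 0) (hns : IsNonsingularForm K F) : Finite (linStabilizer F) := by
  classical
  exact finite_linStabilizer_of_forall_sum_smul_X_mul_pderiv F
    fun M hM => eq_zero_of_sum_smul_X_mul_pderiv_eq_zero hF hd hdK hns M hM

/-- **Poonen 2005, Thm. 2, for every algebraically closed field `K` with `(d : K) ≠ 0`**
(p0002:L9: "If `n ≥ 1` and `d ≥ 3`, then `Lin X` is finite"): the body of the typed fact
`poonen2005_thm_2` with the single extra hypothesis `(d : K) ≠ 0` — for a nonsingular form `f` of
degree `d ≥ 3` in `n + 2` variables, the projective linear stabiliser `𝔾_f` consists of the scalar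
multiples of finitely many matrices. From
`finite_linStabilizer_of_isNonsingularForm_of_natCast_ne_zero` and `𝔾_f = K^× · stab(f)`
(`exists_smul_mem_linStabilizer_of_mem_projLinStabilizer`, `d`-th roots in `K`). The hypothesis
`1 ≤ n` is carried only to match the fact's shape. What stays OPEN: characteristic `p ∣ d`
(Matsumura–Monsky's group-level argument), hence the fact itself. [cite: Poonen2005, Thm. 2] -/
theorem poonen2005_thm_2_of_natCast_ne_zero (K : Type*) [Field K] [IsAlgClosed K] (n d : ℕ)
    (_hn : 1 ≤ n) (hd : 3 ≤ d) (hdK : (d : K) ≠ 0)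
    (f : MvPolynomial (Fin (n + 2)) K) (hf : f.IsHomogeneous d) (hns : IsNonsingularForm K f) :
    ∃ T : Finset (GL (Fin (n + 2)) K), ∀ γ ∈ projLinStabilizer f, ∃ t ∈ T, ∃ c : K,
      (γ : Matrix (Fin (n + 2)) (Fin (n + 2)) K) = c • (t : Matrix (Fin (n + 2)) (Fin (n + 2)) K) := by
  classical
  haveI : Finite (linStabilizer f) :=
    finite_linStabilizer_of_isNonsingularForm_of_natCast_ne_zero hf hd hdK hns
  have hfin : ((linStabilizer f : Subgroup (GL (Fin (n + 2)) K)) :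
      Set (GL (Fin (n + 2)) K)).Finite := Set.toFinite _
  refine ⟨hfin.toFinset, fun γ hγ => ?_⟩
  obtain ⟨t, δ, ht0, hδ, hδγ⟩ :=
    exists_smul_mem_linStabilizer_of_mem_projLinStabilizer hf (by omega) hγ
  refine ⟨δ, hfin.mem_toFinset.2 hδ, t⁻¹, ?_⟩
  rw [hδγ, smul_smul, inv_mul_cancel₀ ht0, one_smul]

/-- **Poonen 2005, Thm. 2, in characteristic `0`**: every algebraically closed field of
characteristic zero. [cite: Poonen2005, Thm. 2] -/
theorem poonen2005_thm_2_of_charZero (K : Type*) [Field K] [IsAlgClosed K] [CharZero K] (n d : ℕ)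
    (hn : 1 ≤ n) (hd : 3 ≤ d)
    (f : MvPolynomial (Fin (n + 2)) K) (hf : f.IsHomogeneous d) (hns : IsNonsingularForm K f) :
    ∃ T : Finset (GL (Fin (n + 2)) K), ∀ γ ∈ projLinStabilizer f, ∃ t ∈ T, ∃ c : K,
      (γ : Matrix (Fin (n + 2)) (Fin (n + 2)) K) = c • (t : Matrix (Fin (n + 2)) (Fin (n + 2)) K) :=
  poonen2005_thm_2_of_natCast_ne_zero K n d hn hd (by exact_mod_cast (show d ≠ 0 by omega)) f hf hns

end Poonen

/-! ### The `ℂ`-bridge to `glAnn` -/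

section ComplexBridge

variable {σ : Type*} [Fintype σ]

/-- **`ℂ`-bridge.** Over `ℂ` the definition-free Lie condition of this file is `glAnn P = ⊥`
(`GLAnnihilator.mem_glAnn_iff`: `X ∈ 𝔤𝔩(W)_P ↔ Σ_{a,b} X_{ab} x_a ∂_b P = 0`), so `ℂ`-consumers of
`finite_linStabilizer_of_forall_sum_smul_X_mul_pderiv` convert in one line.
[cite: LandsbergManivelRessayre2013, §3.5 (p. 481)] -/
theorem forall_sum_smul_X_mul_pderiv_iff_glAnn_eq_bot (P : MvPolynomial σ ℂ) :
    (∀ M : Matrix σ σ ℂ, ∑ a, ∑ b, M a b • (X a * pderiv b P : MvPolynomial σ ℂ) = 0 → M = 0) ↔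
      glAnn P = ⊥ := by
  rw [Submodule.eq_bot_iff]
  exact forall_congr' fun M => by rw [mem_glAnn_iff]

/-- Check: over `ℂ` the field-general finiteness criterion specialises to the statement of
`BI17FiniteStabilizerLocusProofs.finite_linStabilizer_of_glAnn_eq_bot`. -/
example [DecidableEq σ] (P : MvPolynomial σ ℂ) (h : glAnn P = ⊥) : Finite (linStabilizer P) :=
  finite_linStabilizer_of_forall_sum_smul_X_mul_pderiv P
    ((forall_sum_smul_X_mul_pderiv_iff_glAnn_eq_bot P).2 h)

/-- Check: at `K = ℂ` the present file recovers the statement of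
`SmoothFormFiniteStabilizer.poonen2005_thm_2_complex`. -/
example (n d : ℕ) (hn : 1 ≤ n) (hd : 3 ≤ d) (F : MvPolynomial (Fin (n + 2)) ℂ)
    (hF : F.IsHomogeneous d) (hns : IsNonsingularForm ℂ F) :
    ∃ T : Finset (GL (Fin (n + 2)) ℂ), ∀ γ ∈ projLinStabilizer F, ∃ t ∈ T, ∃ c : ℂ,
      (γ : Matrix (Fin (n + 2)) (Fin (n + 2)) ℂ) = c • (t : Matrix (Fin (n + 2)) (Fin (n + 2)) ℂ) :=
  poonen2005_thm_2_of_charZero ℂ n d hn hd F hF hns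

end ComplexBridge

end Literature.Computability.AlgebraicComplexity

end
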